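import Literature.AnabelianGeometry.EtaleTheta.GalSectThm110iii
import Literature.AnabelianGeometry.EtaleTheta.GalSectCuspPairTorsorsProofs
import Literature.AnabelianGeometry.EtaleTheta.GalSectCuspPairTransport
import Literature.AnabelianGeometry.EtaleTheta.Thm110HypothesisRefl
import HarnessLib

/-!
# [EtTh] Thm. 1.10 (iii) over the [GalSect] carrier: the typed statement PROVED modulo transport binders
# — and what that says about its strength (proof-only)

Mochizuki, *The étale theta function …* [EtTh], Publ. RIMS **45** (2009), Thm. 1.10 (iii) p.256 (PRIMS PDF
p.30) [cite: MochizukiEtTh2009, Thm 1.10 (iii) p.30]; [GalSect] = Mochizuki, *Galois sections in absolute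
anabelian geometry*, Nagoya Math. J. **179** (2005), §4 / Def. 4.1 [cite: MochizukiGalSect2005, Def 4.1 p.33].
abc-iut cell, layer L2, offer O1 (abc-iut-L2-lead gen 3, RULINGS #10 (R79) / #11 (R90), GO 05:34Z;
seat abc-iut-w5-d062 gen 2).  PROOF-ONLY: no definitions, no named facts, zero edit of other files.

## What is proved

`thm110iiiGalSect_of_transport`: the typed statement `Thm110iiiGalSect H Sα Sβ Cα Cβ` (ROW (C),
`GalSectThm110iii.lean`) FOLLOWS from
* the LAW of the canonical integral structure at the cusp of `Ċα` — [GalSect] Def. 4.1 (iii): it is an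
  `O_K^×`-structure, `Cα.torsor.IsStructure (GalSect.unitsHat _) Cα.canonical` (the binder that audit
  finding F-w5d016-g3-1 asks every consumer to carry: the field `DotCCusp.canonical` is law-free DATA);
* (b1) CUSP-PAIR TRANSPORT: the extension `Γ` of `γ` to `Π^tp_C` (Prop. 1.8), corrected by an inner
  automorphism of `Π^tp_{Ċβ}`, carries the cuspidal pair `(D, I)` of the cusp of `Ċα` onto that of `Ċβ`
  (decomposition groups of cusps are preserved: [SemiAnbd] Thm. 6.8 (iii) genre, the input of the printed
  proof of (ii), p.256 l.4; sub-DAG row T110.ii.r3);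
* (b2) TORSOR TRANSPORT: a map `e` on splitting classes which IS `Γ` on representatives, equivariant along
  a homomorphism `φ : (K_α^×)^∧ → (K_β^×)^∧` with `φ(μ₂) = μ₂` ([GalSect] §4: functoriality of the torsor
  of splittings in isomorphisms of the data);
* (b3) the canonical integral structures CORRESPOND under `e` ([GalSect] Def. 4.1 (iv)).
`thm110iiiGalSect_of_refl` / `exists_thm110iiiGalSect_refl`: the binders are jointly dischargeable — at
`α = β` with `Γ = id` (the identity witness of `Thm110HypothesisRefl.lean`) the typed (iii) HOLDS OUTRIGHT
given only the law; an unconditional inhabited instance.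
The kernel part is genuine bookkeeping: `GalSect.CuspPair.image_members_eq_members_image` (for EVERY set
of classes `R`, the `Γ`-images of the member splittings of `R` are exactly the member splittings of
`e '' R` — uses `I`-conjugacy transport `Γ(i S i⁻¹) = Γ(i) Γ(S) Γ(i)⁻¹`), the orbit algebra of ROW (B)'s
proofs file, and `μ₂(K) ≤ O_K^×` (`GalSect.rootsOfUnityK_le_unitsOK`).

## What this says (honest census of MY OWN ROW (C) statement — statement strength, said before proving)

The hypotheses `Odd p` and "of standard type" are IDLE in the proof: the typed (iii) is `∃`-SHAPED
("there EXIST `{±1}`-structures … compatible … carried to each other"), whereas print says "`η̈^{Θ,Z}`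
DETERMINES a `{±1}`-structure".  `MuTwoSetting.DotCCusp` carries no evaluation-at-the-cusp datum, so the
clause "determined by `η̈^{Θ,Z}`" (the `{±1}`-structure cut out by the `±1`-normalisation of a class of
standard type, [EtTh] p.256 / Rmk. 1.10.1) is NOT EXPRESSED; as typed, (iii) is [GalSect]/[SemiAnbd]
transport bookkeeping modulo (b1)–(b3).  Carrying print's theta content needs a v-next clause (13:00Z
window; GAP-LEDGER G-w5d062-2).  Contrast: ROW (B)'s `Cor28iiAt` quantifies over ALL automorphisms `Γ`
AFTER choosing the family `R`, so there an `∃`-shape still demands a `Γ`-EQUIVARIANT family — content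
that existence of orbits alone does not supply.

Also landed (audit finding F-w5d016-g3-1, abc-iut-w5-d016 gen 3, in positive contrapositive form): whenever
the typed (iii) / its ROW (A) twin / `Cor28iiAt` fire, the canonical structures they mention are NONEMPTY
(`Thm110iiiGalSect.canonical_nonempty`, `Thm110iii.canonicalIntegral_nonempty`,
`Cor28iiAt.canonical_nonempty`) — so none of them may ever be consumed as a `∀`-closure over the law-free
data.  HONEST FRAMING: nothing printed is asserted; typed ≠ proved; no side taken on [IUTchIII] Cor. 3.12.
-/

namespace Literature.AnabelianGeometry.EtaleTheta

open scoped Pointwise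

open Literature.AnabelianGeometry.SemiGraphs

namespace GalSect

variable {p : ℕ} [Fact p.Prime]

/-- `μ_n(K) ⊆ O_K^×` for `n ≠ 0`: a root of unity has absolute value `1` — PROVED.
[cite: MochizukiGalSect2005, Cor 4.12 p.43] -/
theorem rootsOfUnityK_le_unitsOK (X : TemperedCurve p) {n : ℕ} (hn : n ≠ 0) :
    rootsOfUnityK X n ≤ unitsOK X := by
  intro u hu
  have hu' : u ^ n = 1 := hu
  change ‖((u : X.K) : PadicAlgCl p)‖ = 1
  have h : ‖((u : X.K) : PadicAlgCl p)‖ ^ n = 1 := by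
    have h1 : ((u : X.K) : PadicAlgCl p) ^ n = 1 := by
      have := congrArg (fun v : (↥X.K)ˣ => ((v : X.K) : PadicAlgCl p)) hu'
      simpa using this
    rw [← norm_pow, h1, norm_one]
  exact (pow_eq_one_iff_of_nonneg (norm_nonneg _) hn).1 h

namespace CuspPair

variable {G G' : Type*} [Group G] [TopologicalSpace G] [IsTopologicalGroup G]
  [Group G'] [TopologicalSpace G']

/-- **Members-level transport.**  If `Γ` carries the cuspidal pair `P` onto `P'` and `e` is "`Γ` on
splitting classes" (`e [S] = [Γ(S)]`), then for EVERY set of classes `R` the `Γ`-images of the member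
splittings of `R` are exactly the member splittings of `e '' R` — PROVED (the reverse inclusion moves an
`I'`-conjugate back along `Γ`: `Γ(i S i⁻¹) = Γ(i) Γ(S) Γ(i)⁻¹`).  This is the whole kernel content of
"preserved by `γ`" in the typed [EtTh] Thm. 1.10 (iii) / Cor. 2.8 (ii).
[cite: MochizukiEtTh2009, Thm 1.10 (iii) p.30] -/
theorem image_members_eq_members_image {P : CuspPair G} {P' : CuspPair G'} (Γ : G ≃ₜ* G')
    (hpair : P.map Γ = P') (e : P.SplittingClass → P'.SplittingClass)
    (he : ∀ (S : Subgroup G) (hS : S ∈ P.splittings),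
      ∃ h', e (SplittingClass.mk P S hS) = SplittingClass.mk P' (S.map Γ.toMulEquiv.toMonoidHom) h')
    (R : Set P.SplittingClass) :
    (fun S => S.map Γ.toMulEquiv.toMonoidHom) '' P.members R = P'.members (e '' R) := by
  subst hpair
  ext S'
  constructor
  · rintro ⟨S, ⟨hS, hR⟩, rfl⟩
    obtain ⟨h', he'⟩ := he S hS
    exact ⟨h', _, hR, he'⟩
  · rintro ⟨hS', cα, hcα, hecα⟩
    obtain ⟨S, hS, rfl⟩ := SplittingClass.exists_rep P cα
    obtain ⟨h', he'⟩ := he S hS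
    rw [he'] at hecα
    obtain ⟨i, hi, hS'eq⟩ := (SplittingClass.mk_eq_mk_iff h' hS').1 hecα
    obtain ⟨i₀, hi₀, rfl⟩ := (Subgroup.mem_map.1 hi : ∃ i₀ ∈ P.I, Γ.toMulEquiv.toMonoidHom i₀ = i)
    have h₁ : MulAut.conj i₀ • S ∈ P.splittings := P.conj_mem_splittings (P.I_le hi₀) hS
    refine ⟨MulAut.conj i₀ • S, ⟨h₁, ?_⟩, ?_⟩
    · have hcl : SplittingClass.mk P (MulAut.conj i₀ • S) h₁ = SplittingClass.mk P S hS :=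
        (SplittingClass.mk_eq_mk_iff h₁ hS).2 (P.inertiaConj_equivalence.symm ⟨i₀, hi₀, rfl⟩)
      rw [hcl]
      exact hcα
    · change (MulAut.conj i₀ • S).map Γ.toMulEquiv.toMonoidHom = S'
      rw [hS'eq]
      exact GalSect.map_conj_smul _ i₀ S

end CuspPair

end GalSect

namespace MuTwoSetting

variable {p : ℕ} [Fact p.Prime] (M : MuTwoSetting p)

/-- `{±1} ⊆ O_K^×` inside `(K^×)^∧` (`K = K̈`) — PROVED. [cite: MochizukiEtTh2009, Thm 1.10 (iii) p.30] -/
theorem muTwoHat_le_unitsHat : M.muTwoHat ≤ GalSect.unitsHat M.toThetaSetting.toTemperedCurve := by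
  unfold muTwoHat GalSect.unitsHat
  exact Subgroup.map_mono (GalSect.rootsOfUnityK_le_unitsOK _ two_ne_zero)

end MuTwoSetting

section Thm110iii

variable {p : ℕ} [Fact p.Prime] {Mα Mβ : MuTwoSetting p} {εα : Mα.GtpC} {εβ : Mβ.GtpC}
  {hCα : Mα.toThetaSetting.Compat} {hCβ : Mβ.toThetaSetting.Compat}
  {Eα : Mα.toThetaSetting.EtaleThetaData} {Eβ : Mβ.toThetaSetting.EtaleThetaData}
  {γ : Mα.dotC εα ≃ₜ* Mβ.dotC εβ}

/-- **[EtTh] Thm. 1.10 (iii), typed form, PROVED modulo transport binders.**  Given the law of the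
canonical integral structure at the cusp of `Ċα` (an `O_K^×`-structure, [GalSect] Def. 4.1 (iii)), the
transport of the cuspidal pair along `Γ ∘ Inn(c)` (b1), a `Γ`-compatible, `φ`-equivariant transport `e` of
splitting classes with `φ(μ₂) = μ₂` (b2), and correspondence of the canonical integral structures (b3):
`{±1}`-structures compatible with the canonical integral structures and carried to each other by `γ`
EXIST — namely the `μ₂`-orbit of any member of the canonical structure and its `e`-image.  The standard
type / odd `p` premises are not used (see the module docstring: the typed (iii) is `∃`-shaped).
[cite: MochizukiEtTh2009, Thm 1.10 (iii) p.30] -/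
theorem thm110iiiGalSect_of_transport (H : Thm110Hypothesis εα εβ hCα hCβ Eα Eβ γ)
    (Sα : Mα.StandardData Eα.toKummerData) (Sβ : Mβ.StandardData Eβ.toKummerData)
    (Cα : Mα.DotCCusp εα) (Cβ : Mβ.DotCCusp εβ)
    (hcan : Cα.torsor.IsStructure (GalSect.unitsHat Mα.toThetaSetting.toTemperedCurve) Cα.canonical)
    {c : Mβ.GtpC} (hc : c ∈ Mβ.dotC εβ)
    (hpair : Cα.pair.map (H.Γ.trans (Mβ.innerAutC c)) = Cβ.pair)
    (φ : GalSect.KxHat Mα.toThetaSetting.toTemperedCurve →* GalSect.KxHat Mβ.toThetaSetting.toTemperedCurve)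
    (hφ : Mα.muTwoHat.map φ = Mβ.muTwoHat)
    (e : Cα.pair.SplittingClass → Cβ.pair.SplittingClass)
    (he : ∀ (S : Subgroup Mα.GtpC) (hS : S ∈ Cα.pair.splittings),
      ∃ h', e (GalSect.CuspPair.SplittingClass.mk Cα.pair S hS) =
        GalSect.CuspPair.SplittingClass.mk Cβ.pair
          (S.map (H.Γ.trans (Mβ.innerAutC c)).toMulEquiv.toMonoidHom) h')
    (hequiv : ∀ (k : GalSect.KxHat Mα.toThetaSetting.toTemperedCurve) (cl : Cα.pair.SplittingClass),
      e (Cα.torsor.act k cl) = Cβ.torsor.act (φ k) (e cl))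
    (hecan : e '' Cα.canonical ⊆ Cβ.canonical) :
    Thm110iiiGalSect H Sα Sβ Cα Cβ := by
  intro _ _ _
  have hcan' := hcan
  obtain ⟨c₀, hc₀, -⟩ := hcan'
  have hsub : {c' | ∃ b ∈ Mα.muTwoHat, c' = Cα.torsor.act b c₀} ⊆ Cα.canonical :=
    hcan.orbit_subset Cα.torsor (Mα.muTwoHat_le_unitsHat) hc₀
  refine ⟨{c' | ∃ b ∈ Mα.muTwoHat, c' = Cα.torsor.act b c₀},
    e '' {c' | ∃ b ∈ Mα.muTwoHat, c' = Cα.torsor.act b c₀}, ?_, ?_, c, hc, ?_⟩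
  · exact ⟨Cα.torsor.isStructure_orbit Mα.muTwoHat c₀, hsub⟩
  · refine ⟨⟨e c₀, ⟨c₀, ⟨1, Mα.muTwoHat.one_mem, (Cα.torsor.act_one c₀).symm⟩, rfl⟩, ?_⟩,
      (Set.image_mono hsub).trans hecan⟩
    ext cβ
    constructor
    · rintro ⟨cα, ⟨b, hb, rfl⟩, rfl⟩
      refine ⟨φ b, ?_, hequiv b c₀⟩
      rw [← hφ]
      exact Subgroup.mem_map_of_mem φ hb
    · rintro ⟨b', hb', rfl⟩
      rw [← hφ] at hb'
      obtain ⟨b, hb, rfl⟩ := hb'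
      exact ⟨Cα.torsor.act b c₀, ⟨b, hb, rfl⟩, hequiv b c₀⟩
  · exact ⟨congrArg GalSect.CuspPair.D hpair,
      GalSect.CuspPair.image_members_eq_members_image _ hpair e he _⟩

/-- **The binders are jointly dischargeable: the identity case.**  At `α = β`, for ANY hypothesis
structure whose extension `Γ` is the identity (e.g. the identity witness of `Thm110HypothesisRefl.lean`)
the typed Thm. 1.10 (iii) HOLDS outright, given only the [GalSect] Def. 4.1 (iii) law of the canonical
integral structure (`c = 1`, `φ = id`, `e = id`) — PROVED.  [cite: MochizukiEtTh2009, Thm 1.10 (iii) p.30] -/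
theorem thm110iiiGalSect_of_refl {M : MuTwoSetting p} {εZ : M.GtpC} {hC : M.toThetaSetting.Compat}
    {E : M.toThetaSetting.EtaleThetaData}
    (H : Thm110Hypothesis εZ εZ hC hC E E (ContinuousMulEquiv.refl (M.dotC εZ)))
    (hΓ : H.Γ = ContinuousMulEquiv.refl M.GtpC) (S : M.StandardData E.toKummerData) (C : M.DotCCusp εZ)
    (hcan : C.torsor.IsStructure (GalSect.unitsHat M.toThetaSetting.toTemperedCurve) C.canonical) :
    Thm110iiiGalSect H S S C C := by
  have hid : ∀ x, (H.Γ.trans (M.innerAutC 1)) x = x := by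
    intro x
    rw [hΓ]
    change 1 * x * 1⁻¹ = x
    simp
  have hmap : ∀ S' : Subgroup M.GtpC,
      S'.map (H.Γ.trans (M.innerAutC 1)).toMulEquiv.toMonoidHom = S' := by
    intro S'
    ext x
    constructor
    · rintro ⟨y, hy, rfl⟩
      change (H.Γ.trans (M.innerAutC 1)) y ∈ S'
      rw [hid]
      exact hy
    · intro hx
      exact ⟨x, hx, hid x⟩
  refine thm110iiiGalSect_of_transport H S S C C hcan (M.dotC εZ).one_mem ?_ (MonoidHom.id _) ?_ id
    ?_ (fun _ _ => rfl) (Set.image_id _).subset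
  · exact GalSect.CuspPair.ext' (hmap _) (hmap _)
  · exact Subgroup.map_id _
  · intro S' hS'
    refine ⟨by rw [hmap]; exact hS', ?_⟩
    exact (GalSect.CuspPair.SplittingClass.mk_eq_mk_iff hS' _).2
      ⟨1, C.pair.I.one_mem, by rw [map_one, one_smul, hmap]⟩

/-- Hence, with the identity witness of `Thm110Hypothesis` (`Thm110HypothesisRefl.lean`): for every
`MuTwoSetting`, admissible `ε_Z`, `Compat`, étale theta datum, standard data and cusp datum satisfying the
Def. 4.1 (iii) law, SOME hypothesis structure over the identity `γ` satisfies the typed Thm. 1.10 (iii) —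
an UNCONDITIONAL inhabited instance of the typed statement (consistency / statement-strength evidence: no
theta input is used).  [cite: MochizukiEtTh2009, Thm 1.10 (iii) p.30] -/
theorem exists_thm110iiiGalSect_refl (M : MuTwoSetting p) {εZ : M.GtpC} (hZ : M.IsAdmissibleEpsZ εZ)
    (hC : M.toThetaSetting.Compat) (E : M.toThetaSetting.EtaleThetaData)
    (S : M.StandardData E.toKummerData) (C : M.DotCCusp εZ)
    (hcan : C.torsor.IsStructure (GalSect.unitsHat M.toThetaSetting.toTemperedCurve) C.canonical) :
    ∃ H : Thm110Hypothesis εZ εZ hC hC E E (ContinuousMulEquiv.refl (M.dotC εZ)),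
      Thm110iiiGalSect H S S C C :=
  ⟨{ admα := hZ
     admβ := hZ
     Γ := ContinuousMulEquiv.refl M.GtpC
     preserves := M.preservesCoverings_refl εZ
     restricts := ⟨1, fun x => by rw [inv_one, mul_one, one_mul]; rfl⟩
     γX := ContinuousMulEquiv.refl M.PiTemp
     γX_spec := fun _ => rfl
     thm16i := ThetaSetting.thm16i_refl M.toThetaSetting
     companion := ThetaSetting.ThetaCompanion.ofRefl M.toThetaSetting
     maps_orbit := fun y => by
       constructor
       · intro hy
         exact ⟨y, hy, (ThetaSetting.transport_refl _ _ y).symm⟩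
       · rintro ⟨x, hx, rfl⟩
         rw [ThetaSetting.transport_refl]
         exact hx },
    thm110iiiGalSect_of_refl _ rfl S C hcan⟩

/-- **Settled negative edge, positive form** (audit finding F-w5d016-g3-1, abc-iut-w5-d016 gen 3): whenever
the typed Thm. 1.10 (iii) fires, both canonical integral structures are NONEMPTY — so the statement must be
consumed at data satisfying the [GalSect] Def. 4.1 (iii) law, never as a `∀`-closure over the law-free
field `DotCCusp.canonical` (at `canonical := ∅` it is false).  [cite: MochizukiEtTh2009, Thm 1.10 (iii) p.30] -/
theorem Thm110iiiGalSect.canonical_nonempty {H : Thm110Hypothesis εα εβ hCα hCβ Eα Eβ γ}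
    {Sα : Mα.StandardData Eα.toKummerData} {Sβ : Mβ.StandardData Eβ.toKummerData}
    {Cα : Mα.DotCCusp εα} {Cβ : Mβ.DotCCusp εβ} (h : Thm110iiiGalSect H Sα Sβ Cα Cβ) (hp : Odd p)
    (hα : Mα.IsOfStandardType hCα εα Sα Eα.etaDd) (hβ : Mβ.IsOfStandardType hCβ εβ Sβ Eβ.etaDd) :
    Cα.canonical.Nonempty ∧ Cβ.canonical.Nonempty := by
  obtain ⟨Rα, Rβ, ⟨hRα, hRαsub⟩, ⟨hRβ, hRβsub⟩, -⟩ := h hp hα hβ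
  exact ⟨(hRα.nonempty Cα.torsor).mono hRαsub, (hRβ.nonempty Cβ.torsor).mono hRβsub⟩

/-- The ROW (A) twin (`Thm110iii` over `DotCCuspTorsor`): whenever it fires, both canonical integral
structures are NONEMPTY (F-w5d016-g3-1). [cite: MochizukiEtTh2009, Thm 1.10 (iii) p.30] -/
theorem Thm110iii.canonicalIntegral_nonempty {H : Thm110Hypothesis εα εβ hCα hCβ Eα Eβ γ}
    {Sα : Mα.StandardData Eα.toKummerData} {Sβ : Mβ.StandardData Eβ.toKummerData}
    {Cα : Mα.DotCCuspTorsor εα} {Cβ : Mβ.DotCCuspTorsor εβ} (h : Thm110iii H Sα Sβ Cα Cβ) (hp : Odd p)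
    (hα : Mα.IsOfStandardType hCα εα Sα Eα.etaDd) (hβ : Mβ.IsOfStandardType hCβ εβ Sβ Eβ.etaDd) :
    Cα.canonicalIntegral.Nonempty ∧ Cβ.canonicalIntegral.Nonempty := by
  obtain ⟨Rα, Rβ, ⟨⟨cα, hcα, -⟩, hRαsub⟩, ⟨⟨cβ, hcβ, -⟩, hRβsub⟩, -⟩ := h hp hα hβ
  exact ⟨⟨cα, hRαsub hcα⟩, ⟨cβ, hRβsub hcβ⟩⟩

end Thm110iii

namespace ThetaCovers

namespace TemperedCoverData

universe u

variable {l : ℕ} (T : TemperedCoverData.{u} l)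

/-- The ROW (B) twin (`Cor28iiAt`): whenever it fires, every canonical integral structure `𝒟.canonical g`
is NONEMPTY (F-w5d016-g3-1 addendum) — consume only at data satisfying the Def. 4.1 (iii) law.
[cite: MochizukiEtTh2009, Cor 2.8 (ii) p.42] -/
theorem Cor28iiAt.canonical_nonempty {S : Subgroup T.Gtp} {L : List (Subgroup T.Gtp)} {n : ℕ}
    {A : Type u} [Group A] {𝒟 : T.Cor28iiData S A} (h : T.Cor28iiAt S L n 𝒟) (hμ : T.HasMuL)
    (hres : 𝒟.ResCharPrimeToL) (hrat : ∀ g, T.IsRationalCusp S g) (g : T.Gtp) :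
    (𝒟.canonical g).Nonempty := by
  obtain ⟨R, hR, -⟩ := h hμ hres hrat
  obtain ⟨hRg, hRgsub⟩ := hR g
  exact (hRg.nonempty (𝒟.torsor g)).mono hRgsub

end TemperedCoverData

end ThetaCovers

end Literature.AnabelianGeometry.EtaleTheta
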